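import Mathlib
import HarnessLib
import Summits.KontsevichZagierPeriods.Zeta5Search.Denom.TwoTaleL25Levels
import Summits.KontsevichZagierPeriods.Zeta5Search.Denom.TwoTaleL25DigitTables
import Summits.KontsevichZagierPeriods.Zeta5Search.TwoTaleOmega.OmegaLadder

/-!
# TwoTaleL25Inclusion — the `InclusionL25` input of rung L(2/5) DISCHARGED: `Φₙ ∣ D₃₇ₙD₃₉ₙ qₙ`, `Φₙ⁻¹D₃₇ₙD₃₉ₙ pₙ ∈ ℤ`

HONEST FRAMING: systematic search; no irrationality claim unless certified.

Cell pub-zeta5 (measure-opt g0), the L(2/5) twin of fam-denom's `Denom.TwoTaleD1Inclusion`; `p`-adic/denominator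
bookkeeping only.  Rung L(2/5) of the two-tale ladder is Zudilin's construction [Zudilin2014ZetaTwo] at the cone point
`a = (32,27,22,37)·n + 1`, `b = (1, 5n+1, 10n+1, 64n+2)` with partner `â = (79n+2; 27n+1, 32n+1, 37n+1)`,
`b̂ = (37n+2; 15n+1, 59n+2, 64n+2)` (`TwoTaleL25Forms`).  Its saving product `Φₙ` (`TwoTaleL25Saving`, rate
`S ∈ [39.27798, 39.27811]`) counts the primes `80√n < p ≤ 37n` with digit `ν(n/p) = max(φ, φ̂) ≥ 1` (once) / `= 2`
(twice).  This file proves the inclusion **hypothesis-free**: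

* `bmissL25` — the two-tale coincidence `q(a,b) = −q̂(â,b̂)`, `p(a,b) = −p̂(â,b̂)` for every `n ≥ 1`: fam-tele's kernel
  theorem `TwoTaleOmega.bmiss_Lad` ((bmiss) on the whole ladder plane of the region `Ω`, cert-2's `bmiss_on_Omega`) at the
  ladder point `(Q,P) = (5n, 2n)`, transported to the `TwoTaleL25Forms` names;
* `levelsL25` — for every counted prime the level divisibilities `p^ℓ ∣ qₙ`, `p^ℓ ∣ D₃₇ₙD₃₉ₙ pₙ` from the CHECKED DIGIT
  TABLES (`TwoTaleL25DigitTables.coverL25_sound`: 181 cells, Lemma 7 / Lemma 8 row by row, `decide +kernel`);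
* **`inclusionL25_holds : TwoTaleL25Exponent.InclusionL25`** via `TwoTaleL25Levels.inclusionL25_of_unpacked`;
* the rung's measure theorem with the inclusion discharged: **`zetaTwo_exponent_le_L25`** —
  `DecayL25 71.44179 → CoeffRateL25 C₁ → 0 < C₁ ≤ 102.84495 → ExponentLE (zetaValue 2) 5.01982`.  The two remaining inputs
  (tale-1 decay `TwoTaleL25Decay`, coefficient growth `TwoTaleL25GrowthLimit`/`…Enclosure`) are assembled in
  `TwoTaleL25Measure`; until then **5.01982 is a DESIGN value**, and in any case it concerns the known-irrational `ζ(2)`: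
  nothing here bears on `ζ(5)`.  0 sorry; standard axioms.
References: W. Zudilin, arXiv:1310.1526 [Zudilin2014ZetaTwo], Lemmas 7–8, §5.
-/

namespace Summit.KontsevichZagierPeriods.Zeta5Search.Denom.TwoTaleL25Inclusion

open Literature.NumberTheory.Transcendental
open Literature.NumberTheory.Irrationality.Zudilin2014
open Summit.KontsevichZagierPeriods.Zeta5Search.Denom.TwoTaleL25Saving (ivlL25)
open Summit.KontsevichZagierPeriods.Zeta5Search.Denom.TwoTaleL25Forms
open Summit.KontsevichZagierPeriods.Zeta5Search.Denom.TwoTaleL25Exponent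
open Summit.KontsevichZagierPeriods.Zeta5Search.Denom.TwoTaleL25Levels
open Summit.KontsevichZagierPeriods.Zeta5Search.Denom.TwoTaleL25DigitTables
open Summit.KontsevichZagierPeriods.Zeta5Search.TwoTaleOmega

/-! ### The two inputs of the level divisibilities -/

/-- The ladder point `Lad(5n, 2n)` has the L(2/5) tale data: `a = (32,27,22,37)·n+1`, `b = (1,5n+1,10n+1,64n+2)`,
`â = (79n+2;27n+1,32n+1,37n+1)`, `b̂ = (37n+2;15n+1,59n+2,64n+2)`. -/
theorem Lad_L25_tales (n : ℕ) : (Pt.Lad (5 * (n : ℤ)) (2 * (n : ℤ))).t1a = aL25 n ∧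
    (Pt.Lad (5 * (n : ℤ)) (2 * (n : ℤ))).t1b = bL25 n ∧ (Pt.Lad (5 * (n : ℤ)) (2 * (n : ℤ))).t2a = aTL25 n ∧
    (Pt.Lad (5 * (n : ℤ)) (2 * (n : ℤ))).t2b = bTL25 n := by
  refine ⟨?_, ?_, ?_, ?_⟩ <;> (ext i; fin_cases i <;> simp [Pt.t1a, Pt.t1b, Pt.t2a, Pt.t2b, Pt.Lad] <;> ring)

/-- **(bmiss) at L(2/5)** in the `TwoTaleL25Forms` names: `q(a,b) = −q̂(â,b̂)` and `p(a,b) = −p̂(â,b̂)` for `n ≥ 1`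
(fam-tele's `TwoTaleOmega.bmiss_Lad` at `(Q,P) = (5n,2n)`). -/
theorem bmissL25 {n : ℕ} (hn : 1 ≤ n) :
    formQ (aL25 n) (bL25 n) = -formQT (aTL25 n) (bTL25 n) ∧ formP (aL25 n) (bL25 n) = -formPT (aTL25 n) (bTL25 n) := by
  have h1 : (1 : ℤ) ≤ n := by exact_mod_cast hn
  have h := bmiss_Lad (5 * (n : ℤ)) (2 * (n : ℤ)) (by omega) (by omega)
  obtain ⟨e1, e2, e3, e4⟩ := Lad_L25_tales n
  unfold Pt.Bmiss at h
  rw [e1, e2, e3, e4] at h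
  exact h

/-- **`D₃₇ₙD₃₉ₙ pₙ` is the integer `formPZ (aL25 n) (bL25 n) (37n) (39n)`** (Prop. 1 with `M₁ = 37n ≥ aⱼ − bⱼ, b₄ − a₂* − 1`
and `M₂ = 39n ≥ d + 1, b₄ − a₂* − 1`). -/
theorem lcmNormaliserL25_mul_formPL25 {n : ℕ} (hn : 1 ≤ n) :
    ((lcmNormaliserL25 n : ℕ) : ℚ) * formPL25 n = (formPZ (aL25 n) (bL25 n) (37 * n) (39 * n) : ℚ) := by
  have hc : ∀ j : Fin 4, j ≠ 3 → (aL25 n j - bL25 n j).toNat ≤ 37 * n := fun j hj => by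
    have h := sideL25_M n j j hj
    rwa [aOne_slopeL25, bOne_betaL25] at h
  have hK := sideL25_K n
  have hd := sideL25_d hn
  rw [aOne_slopeL25, bOne_betaL25] at hK hd
  rw [lcmNormaliserL25, formPL25, Nat.cast_mul]
  exact formP_eq_cast (admissibleL25 hn) hc hK.1 hK.2 hd

/-! ### Level divisibilities from the digit tables -/

/-- **Level divisibilities at L(2/5)** (`n ≥ 1`): for a prime `p ≤ 37n` with `6400 n < p²` counted in `ivlL25 i`,
`p ∣ qₙ`, `p ∣ D₃₇ₙD₃₉ₙpₙ` (`i < 26`) and `p² ∣ qₙ`, `p² ∣ D₃₇ₙD₃₉ₙpₙ` (`26 ≤ i < 54`) — the digit tables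
(`coverL25_sound`) fed with (bmiss) (`bmissL25`). -/
theorem levelsL25 {n : ℕ} (hn : 1 ≤ n) :
    (∀ i < 26, ∀ p : ℕ, p.Prime → p ≤ 37 * n → 6400 * n < p ^ 2 →
      (ivlL25 i).1 ≤ Int.fract ((n : ℝ) / p) → Int.fract ((n : ℝ) / p) < (ivlL25 i).2 →
        (p : ℤ) ∣ formQZ (aL25 n) (bL25 n) ∧ (p : ℤ) ∣ formPZ (aL25 n) (bL25 n) (37 * n) (39 * n)) ∧
    (∀ i, 26 ≤ i → i < 54 → ∀ p : ℕ, p.Prime → p ≤ 37 * n → 6400 * n < p ^ 2 →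
      (ivlL25 i).1 ≤ Int.fract ((n : ℝ) / p) → Int.fract ((n : ℝ) / p) < (ivlL25 i).2 →
        (p : ℤ) ^ 2 ∣ formQZ (aL25 n) (bL25 n) ∧ (p : ℤ) ^ 2 ∣ formPZ (aL25 n) (bL25 n) (37 * n) (39 * n)) := by
  obtain ⟨hbq, hbp⟩ := bmissL25 hn
  refine ⟨fun i hi p hp hple hsq hu hv => ?_, fun i hi hi' p hp hple hsq hu hv => ?_⟩
  · have h := coverL25_sound (by omega) hn hp hple hsq hbq hbp hu hv
    rwa [if_pos hi, pow_one] at h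
  · have h := coverL25_sound hi' hn hp hple hsq hbq hbp hu hv
    rwa [if_neg (not_lt.2 hi)] at h

/-! ### The inclusion, hypothesis-free -/

/-- **`InclusionL25` holds**: `Φₙ ∣ D₃₇ₙD₃₉ₙ qₙ` and `Φₙ⁻¹ D₃₇ₙD₃₉ₙ pₙ ∈ ℤ` for every `n ≥ 1`. -/
theorem inclusionL25_holds : InclusionL25 :=
  inclusionL25_of_unpacked
    (fun _ hn => ⟨fun i hi p hp hple hsq hu hv => ((levelsL25 hn).1 i hi p hp hple hsq hu hv).1,
      fun i hi hi' p hp hple hsq hu hv => ((levelsL25 hn).2 i hi hi' p hp hple hsq hu hv).1⟩)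
    fun n hn => ⟨formPZ (aL25 n) (bL25 n) (37 * n) (39 * n), lcmNormaliserL25_mul_formPL25 hn,
      fun i hi p hp hple hsq hu hv => ((levelsL25 hn).1 i hi p hp hple hsq hu hv).2,
      fun i hi hi' p hp hple hsq hu hv => ((levelsL25 hn).2 i hi hi' p hp hple hsq hu hv).2⟩

/-! ### The rung's measure theorem with the inclusion discharged -/

/-- **Rung L(2/5) from the two tale-1 inputs (PROVED implication; `InclusionL25` discharged above):**
`DecayL25 71.44179 → CoeffRateL25 C₁ → 0 < C₁ ≤ 102.84495 → μ(ζ(2)) ≤ 5.01982` (`ExponentLE`).  The inputs are the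
tale-1 saddle theorems (`TwoTaleL25Decay`, `TwoTaleL25GrowthLimit` / `TwoTaleL25GrowthEnclosure`); 5.01982 stays a DESIGN
value until the capstone `TwoTaleL25Measure` lands; `ζ(2)` is known to be irrational — no claim about `ζ(5)`. -/
theorem zetaTwo_exponent_le_L25 {C₁ : ℝ} (hD : DecayL25 71.44179) (hC : CoeffRateL25 C₁) (hC₀ : 0 < C₁)
    (hC₁ : C₁ ≤ 102.84495) : ExponentLE (zetaValue 2) 5.01982 :=
  zetaTwo_exponent_le_L25_of_inputs inclusionL25_holds hD hC hC₀ hC₁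

/-- Loose-constant variant: `DecayL25 71.4 → CoeffRateL25 C₁ → 0 < C₁ ≤ 102.9 → μ(ζ(2)) ≤ 5.028`. -/
theorem zetaTwo_exponent_le_L25_loose' {C₁ : ℝ} (hD : DecayL25 71.4) (hC : CoeffRateL25 C₁) (hC₀ : 0 < C₁)
    (hC₁ : C₁ ≤ 102.9) : ExponentLE (zetaValue 2) 5.028 :=
  zetaTwo_exponent_le_L25_loose inclusionL25_holds hD hC hC₀ hC₁

end Summit.KontsevichZagierPeriods.Zeta5Search.Denom.TwoTaleL25Inclusion
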